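import Summits.QuantumFields.BalabanUV.Beta.D1BFx.GhostStencilRooted

/-!
# `BalabanUV.Beta.D1BFx.GhostStencilRootedReflection` — road «BF-x» for binder row D1, sub-leaf T6-ρ (part B): THE POINT-REFLECTION
# TRANSPORT OF an1's AXIAL CONTOUR (all axes at once) AND THE INVERSION LAW OF THE CENTRE-ROOTED AVERAGING JET FOR ODD `n` —
# `SghAt (ctrHalf n) n cK cQ κ′ (cInv n κ′ − u) = (−1) • refK (invLeg n) (SghAt (ctrHalf n) n cK cQ κ′ u)`: the END's `hSr` shape for the
# re-rooted T6 stencil, with the SAME relabelling, bond map and sign as the current (part 2) and the `ghX` contact (parts 2/4)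

HONEST DEPENDENCY (page 1, mandatory): continuum YM on T⁴ ⇐ BetaPertH ∧ nine spine estimates (0/9 proved); BetaPertH ⇐ (D1) ∧ (D4) ∧
CAP+tail; G-an2-4 gates asym, D1 and NE2/3/4.  HONEST FRAMING (cell contract, verbatim): «discharging `BetaPertH` makes Bałaban's UV
stability UNCONDITIONAL — a real constructive-QFT result; it is NOT the continuum limit and NOT the Clay problem.»  THIS FILE DISCHARGES
NOTHING of D1 / BetaPertH: [folklore] list/finite-sum bookkeeping about an1's `AveragingContours.axial` and part A's objects, two small new
objects (`reflForm`, `ctrHalf` — definitions asserting nothing); 0 binders of the hR root are touched; no `def … : Prop`, no citation,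
nothing printed as hypothesis (B12 p. 251 «L is an odd, positive integer … a center at y» is a LOCATOR for why odd `n` and the centre).
ABSOLUTE RULE (cell charter, verbatim): «No internally-minted statement may enter as a cited fact. Every hypothesis is either
kernel-proved in this package or a verbatim quotation of a PUBLISHED theorem with page reference. The manuscript(s) under audit are NOT
citable for their own disputed steps — they are the thing under adjudication; programme-internal (2001/route/tribunal) claims are never
citable.»

CONTENT.
* §1 [our object] `reflForm t A κ w := −A κ (t − w − e_κ)` (the pull-back of a 1-form under the point reflection `x ↦ t − x`: the bond
  `⟨w, w+e_κ⟩` goes to the REVERSED bond based at `t − w − e_κ`) and [folklore] the TRANSPORT LEMMAS `segDown/segUp/seg_pointReflect`,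
  `corner_pointReflect`, `axialAux/axial_pointReflect : axial A (t − y) (t − x) = axial (reflForm t A) y x` (an1's fixed axis order is
  kept; forward segments become backward ones — cons recursions only, cf. an5's `RootedComb.axial_R1` for one axis), `reflForm_bondForm`,
  **`gammaCoeff_pointReflect : γ(κ′, u; t − r, t − x) = −γ(κ′, t − e_κ′ − u; r, x)`**.
* §2 [our object] the CENTRED ROOT `ctrHalf n := ((n−1)/2)·𝟙` (in-block for every `n ≥ 1`; for ODD `n`, `ctrHalf n + ctrHalf n = ctrVec n`,
  so the point inversion maps the root lattice `n•Y + ctrHalf n` to itself: `root_pointReflect`); `blk_pointReflect` (part 1's `blk_reflAt`).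
* §3 [folklore] **THE LAWS** (odd `n`): `qJetAt_ctr_pointReflect`, **`qAntiAt_pointInversion`**, **`SghAt_pointInversion`** (any `cK cQ`)
  — the `hSr` socket of `FineHessianReflection.bondSecondMoment_TOfLeg_eq_avgM2_of_refl` for the centre-rooted T6 stencil with
  `(Φ, c, σ) = (invLeg n, cInv n, −1)`; contrast part 3's NO-GO for the corner root `ρ = 0`.
NOT HERE: even `n` (no inversion-stable root lattice), the `Q′(U)` second jets, the END re-instantiated on `(Ggh, SghAt, (cW/2)•ghX)` (the
T7-gh lineage's object once the owner rules), anything printed.  Unit `b2b-balaban-beta-d1-formalise-leaf-01` (gen 3).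
-/

noncomputable section

namespace Summit.QuantumFields.BalabanUV.Beta.D1BFx.GhostStencilRootedReflection

open Finset
open scoped BigOperators
open Literature.MathematicalPhysics.QuantumFieldTheory.Balaban1983to89
open Literature.MathematicalPhysics.QuantumFieldTheory.Balaban1983to89.Beta
open B6QGQLower276 (blk)
open ExpKernelCalculus (Site MKer)
open AffineAveraging (Form1 unitVec unitVec_apply)
open AveragingContours (seg segUp segDown corner axialAux axial axial_sum_sub)
open KernelReflection (refK)
open Summit.QuantumFields.BalabanUV.Beta.D1BFx.GhostLeg (blk_pred_apply)
open Summit.QuantumFields.BalabanUV.Beta.D1BFx.GhostStencil (bondForm gammaCoeff ghCur)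
open Summit.QuantumFields.BalabanUV.Beta.D1BFx.GhostLegReflection (invLeg reflAt reflAt_pred_apply blk_reflAt)
open Summit.QuantumFields.BalabanUV.Beta.D1BFx.GhostStencilReflection (ctrVec cInv refK_invLeg_apply refK_invLeg_ghCur)
open Summit.QuantumFields.BalabanUV.Beta.D1BFx.GhostStencilDivergence (axial_sum_zero)
open Summit.QuantumFields.BalabanUV.Beta.D1BFx.GhostStencilRooted (qJetAt qAntiAt qAntiAt_apply SghAt SghAt_apply qJetAt_eq_unguarded)

/-! ## §1 The point-reflection transport of the axial contour -/

/-- [our object] **THE REFLECTED 1-FORM**: `reflForm t A κ w := −A κ (t − w − e_κ)` — reading `A` on the image of the bond `⟨w, w + e_κ⟩`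
under `x ↦ t − x`, which is the bond `⟨t − w − e_κ, t − w⟩` traversed BACKWARDS.  A definition; asserts nothing. -/
def reflForm (t : Site 4) (A : Form1 4 ℝ) : Form1 4 ℝ := fun κ w => -A κ (t - w - unitVec κ)

variable (t : Site 4) (A : Form1 4 ℝ)

/-- [our object] Unfolding `reflForm`. -/
theorem reflForm_apply (κ : Fin 4) (w : Site 4) : reflForm t A κ w = -A κ (t - w - unitVec κ) := rfl

/-- [folklore] A backward segment from `t − c` reads the reflected form forward from `c`. -/
theorem segDown_pointReflect (c : Site 4) (κ : Fin 4) : ∀ m : ℕ, segDown A (t - c) κ m = segUp (reflForm t A) c κ m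
  | 0 => by simp
  | m + 1 => by
      rw [AveragingContours.segDown_succ, AveragingContours.segUp_succ, segDown_pointReflect c κ m, reflForm_apply]
      congr 3
      rw [add_smul, one_smul]
      abel

/-- [folklore] A forward segment from `t − c` reads the reflected form backward from `c`. -/
theorem segUp_pointReflect (c : Site 4) (κ : Fin 4) : ∀ m : ℕ, segUp A (t - c) κ m = segDown (reflForm t A) c κ m
  | 0 => by simp
  | m + 1 => by
      rw [AveragingContours.segDown_succ, AveragingContours.segUp_succ, segUp_pointReflect c κ m, reflForm_apply, neg_neg]
      congr 3
      rw [add_smul, one_smul]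
      abel

/-- [folklore] The signed segment: `seg A (t − c) κ (−ℓ) = seg (reflForm t A) c κ ℓ`. -/
theorem seg_pointReflect (c : Site 4) (κ : Fin 4) (ℓ : ℤ) : seg A (t - c) κ (-ℓ) = seg (reflForm t A) c κ ℓ := by
  unfold seg
  rcases lt_trichotomy ℓ 0 with h | h | h
  · rw [if_pos (by omega), if_neg (by omega), segUp_pointReflect]
  · subst h; simp
  · rw [if_neg (by omega), if_pos (by omega), neg_neg, segDown_pointReflect]

/-- [folklore] Intermediate corners are reflected: `corner (t − y) (t − x) m = t − corner y x m`. -/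
theorem corner_pointReflect (y x : Site 4) (m : ℕ) : corner (t - y) (t - x) m = t - corner y x m := by
  funext j
  show (if m ≤ (j : ℕ) then (t - x) j else (t - y) j) = (t - corner y x m) j
  rw [Pi.sub_apply, Pi.sub_apply, Pi.sub_apply]
  show (if m ≤ (j : ℕ) then t j - x j else t j - y j) = t j - (if m ≤ (j : ℕ) then x j else y j)
  split_ifs <;> rfl

/-- [folklore] Transport of the partial axial contour. -/
theorem axialAux_pointReflect (y x : Site 4) : ∀ m : ℕ, axialAux A (t - y) (t - x) m = axialAux (reflForm t A) y x m
  | 0 => rfl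
  | m + 1 => by
      simp only [axialAux, axialAux_pointReflect y x m, corner_pointReflect]
      split_ifs with h
      · rw [Pi.sub_apply, Pi.sub_apply, show t ⟨m, h⟩ - x ⟨m, h⟩ - (t ⟨m, h⟩ - y ⟨m, h⟩) = -(x ⟨m, h⟩ - y ⟨m, h⟩) by ring,
          seg_pointReflect]
      · rfl

/-- [folklore] **TRANSPORT OF an1's AXIAL CONTOUR UNDER THE POINT REFLECTION `x ↦ t − x`** (all axes; the fixed axis order is kept and
every segment reverses direction): `axial A (t − y) (t − x) = axial (reflForm t A) y x`. -/
theorem axial_pointReflect (y x : Site 4) : axial A (t - y) (t - x) = axial (reflForm t A) y x :=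
  axialAux_pointReflect t A y x 4

/-- [folklore] The reflected bond indicator is MINUS the indicator of the reversed image bond:
`reflForm t (bondForm κ′ u) = −bondForm κ′ (t − e_κ′ − u)`. -/
theorem reflForm_bondForm (κ' : Fin 4) (u : Site 4) : reflForm t (bondForm κ' u) = -bondForm κ' (t - unitVec κ' - u) := by
  funext κ w
  rw [reflForm_apply, Pi.neg_apply, Pi.neg_apply]
  unfold bondForm
  by_cases hκ : κ = κ'
  · subst hκ
    have hiff : (t - w - unitVec κ = u) ↔ (w = t - unitVec κ - u) := by
      constructor
      · intro h; rw [← h]; abel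
      · intro h; rw [h]; abel
    simp only [true_and, hiff]
  · rw [if_neg (fun h => hκ h.1), if_neg (fun h => hκ h.1)]

/-- [folklore] Contour sums of a negated form. -/
theorem axial_sum_neg (B : Form1 4 ℝ) (y x : Site 4) : (axial (-B) y x).sum = -(axial B y x).sum := by
  have h := axial_sum_sub (0 : Form1 4 ℝ) B y x
  rw [zero_sub, axial_sum_zero] at h
  linarith

/-- [folklore] **THE CONTOUR COEFFICIENT UNDER THE POINT REFLECTION**: `γ(κ′, u; t − r, t − x) = −γ(κ′, t − e_κ′ − u; r, x)` — the signed
multiplicity of a bond in the reflected contour is minus that of the reversed image bond in the original contour. -/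
theorem gammaCoeff_pointReflect (κ' : Fin 4) (u r x : Site 4) :
    gammaCoeff κ' u (t - r) (t - x) = -gammaCoeff κ' (t - unitVec κ' - u) r x := by
  unfold gammaCoeff
  rw [axial_pointReflect, reflForm_bondForm, axial_sum_neg]

/-! ## §2 The centred root -/

/-- [our object] **THE CENTRED ROOT OFFSET** `ctrHalf n := ((n − 1)/2)·𝟙` (integer division; for odd `n` the exact block centre, an1's
`AveragingContoursRooted.ctr`).  A definition; asserts nothing. -/
def ctrHalf (n : ℕ) : Site 4 := fun _ => ((n : ℤ) - 1) / 2

variable (n : ℕ) [NeZero n]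

/-- [folklore] The centred root offset is in-block: `0 ≤ (n−1)/2 < n`. -/
theorem ctrHalf_mem (i : Fin 4) : 0 ≤ ctrHalf n i ∧ ctrHalf n i < n := by
  have hn : (1 : ℤ) ≤ n := by exact_mod_cast NeZero.one_le
  show 0 ≤ ((n : ℤ) - 1) / 2 ∧ ((n : ℤ) - 1) / 2 < n
  omega

omit [NeZero n] in
/-- [folklore] For ODD `n` the centre is exact: `ctrHalf n + ctrHalf n = ctrVec n` (`2·((n−1)/2) = n − 1`). -/
theorem ctrHalf_add_ctrHalf (hodd : Odd n) : ctrHalf n + ctrHalf n = ctrVec n := by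
  obtain ⟨k, hk⟩ := hodd
  funext i
  show ((n : ℤ) - 1) / 2 + ((n : ℤ) - 1) / 2 = (n : ℤ) - 1
  subst hk
  push_cast
  omega

omit [NeZero n] in
/-- [folklore] **THE ROOT LATTICE IS INVERSION-STABLE** (odd `n`): `ctrVec n − (n•Y + ctrHalf n) = n•(−Y) + ctrHalf n`. -/
theorem root_pointReflect (hodd : Odd n) (Y : Site 4) : ctrVec n - ((n : ℤ) • Y + ctrHalf n) = (n : ℤ) • (-Y) + ctrHalf n := by
  rw [← ctrHalf_add_ctrHalf n hodd, smul_neg]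
  abel

/-- [folklore] Part 1's point inversion in coordinates: `reflAt univ (n−1) x = ctrVec n − x`. -/
theorem reflAt_univ_eq (x : Site 4) : (reflAt Finset.univ (n - 1) x : Site 4) = ctrVec n - x := by
  funext μ
  rw [reflAt_pred_apply n, if_pos (Finset.mem_univ μ), Pi.sub_apply]
  rfl

/-- [folklore] **BLOCKS GO TO OPPOSITE BLOCKS**: `blk (ctrVec n − x) = −blk x` (part 1's `blk_reflAt` on all axes). -/
theorem blk_pointReflect (x : Site 4) : blk (n - 1) (ctrVec n - x) = -blk (n - 1) x := by
  rw [← reflAt_univ_eq n x]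
  funext μ
  rw [blk_reflAt, if_pos (Finset.mem_univ μ), Pi.neg_apply]

/-! ## §3 The inversion law of the centre-rooted averaging jet (odd `n`) -/

/-- [folklore] **THE CENTRE-ROOTED JET UNDER THE POINT INVERSION** (odd `n`):
`qJetAt c n κ′ u (−Y) (ctrVec n − w) = −qJetAt c n κ′ (cInv n κ′ − u) Y w`, `c = ctrHalf n`. -/
theorem qJetAt_ctr_pointReflect (hodd : Odd n) (κ' : Fin 4) (u Y w : Site 4) :
    qJetAt (ctrHalf n) n κ' u (-Y) (ctrVec n - w) = -qJetAt (ctrHalf n) n κ' (cInv n κ' - u) Y w := by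
  rw [qJetAt_eq_unguarded n (ctrHalf_mem n), qJetAt_eq_unguarded n (ctrHalf_mem n), blk_pointReflect]
  simp only [neg_inj]
  rw [← root_pointReflect n hodd, gammaCoeff_pointReflect]
  have hc : ctrVec n - unitVec κ' - u = cInv n κ' - u := rfl
  rw [hc]
  split_ifs <;> ring

/-- [folklore] **INVERSION LAW OF THE CENTRE-ROOTED STRIPPED `Q′(U)*Q′(U)`-JET** (odd `n`):
`qAntiAt c n κ′ (cInv n κ′ − u) = (−1) • refK (invLeg n) (qAntiAt c n κ′ u)` — the `hSr` shape with EXACTLY the current's `(Φ, c, σ)`;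
contrast `GhostStencilReflectionQ.qAnti_no_pointInversion_law` for the corner root. -/
theorem qAntiAt_pointInversion (hodd : Odd n) (κ' : Fin 4) (u : Site 4) :
    qAntiAt (ctrHalf n) n κ' (cInv n κ' - u) = (-1 : ℝ) • refK (invLeg n) (qAntiAt (ctrHalf n) n κ' u) := by
  funext x z a b
  rw [Pi.smul_apply, Pi.smul_apply, Pi.smul_apply, Pi.smul_apply, smul_eq_mul, refK_invLeg_apply, qAntiAt_apply, qAntiAt_apply,
    blk_pointReflect, blk_pointReflect, qJetAt_ctr_pointReflect n hodd, qJetAt_ctr_pointReflect n hodd]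
  ring

/-- [folklore] The same, entrywise and unsigned: `qAntiAt c n κ′ u (t − x) (t − z) = −qAntiAt c n κ′ (cInv n κ′ − u) x z`. -/
theorem qAntiAt_ctr_reflect_apply (hodd : Odd n) (κ' : Fin 4) (u x z : Site 4) (a b : Unit) :
    qAntiAt (ctrHalf n) n κ' u (ctrVec n - x) (ctrVec n - z) a b = -qAntiAt (ctrHalf n) n κ' (cInv n κ' - u) x z a b := by
  have h := congr_fun (congr_fun (congr_fun (congr_fun (qAntiAt_pointInversion n hodd κ' u) x) z) a) b
  rw [Pi.smul_apply, Pi.smul_apply, Pi.smul_apply, Pi.smul_apply, smul_eq_mul, refK_invLeg_apply] at h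
  linarith

/-- [folklore] The current, entrywise and unsigned (part 2's `refK_invLeg_ghCur`). -/
theorem ghCur_ctr_reflect_apply (κ' : Fin 4) (u x z : Site 4) (a b : Unit) :
    ghCur κ' u (ctrVec n - x) (ctrVec n - z) a b = -ghCur κ' (cInv n κ' - u) x z a b := by
  have h := congr_fun (congr_fun (congr_fun (congr_fun (refK_invLeg_ghCur n κ' u) x) z) a) b
  rw [refK_invLeg_apply, Pi.neg_apply, Pi.neg_apply, Pi.neg_apply, Pi.neg_apply] at h
  exact h

/-- [folklore] **INVERSION LAW OF THE CENTRE-ROOTED FIRST-ORDER GHOST STENCIL** (odd `n`, ANY weights `cK cQ`):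
`SghAt c n cK cQ κ′ (cInv n κ′ − u) = (−1) • refK (invLeg n) (SghAt c n cK cQ κ′ u)` — the `hSr` socket of the R5 parity ENDs for the
re-rooted T6 stencil, with the same `(invLeg n, cInv n, σ ≡ −1)` as the `ghX` contact's `hTr` (`smul_ghX_pointInversion`). -/
theorem SghAt_pointInversion (hodd : Odd n) (cK cQ : ℝ) (κ' : Fin 4) (u : Site 4) :
    SghAt (ctrHalf n) n cK cQ κ' (cInv n κ' - u) = (-1 : ℝ) • refK (invLeg n) (SghAt (ctrHalf n) n cK cQ κ' u) := by
  funext x z a b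
  rw [Pi.smul_apply, Pi.smul_apply, Pi.smul_apply, Pi.smul_apply, smul_eq_mul, refK_invLeg_apply, SghAt_apply, SghAt_apply,
    ghCur_ctr_reflect_apply, qAntiAt_ctr_reflect_apply n hodd]
  ring

end Summit.QuantumFields.BalabanUV.Beta.D1BFx.GhostStencilRootedReflection

end
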